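import Literature.AlgebraicGeometry.ShimuraVarieties.UnitaryShimuraSetGenericStabilizer
import HarnessLib

/-!
# Rigidity of Hecke translates of the unitary Shimura CURVE, points level: a translate fixing `[v, bN]` for `v` in an open set is `𝟙`

Topic `AlgebraicGeometry/ShimuraVarieties`; namespace `Literature.AlgebraicGeometry.ShimuraVarieties.UnitaryCanonicalModel`
(home of ★ `RecordSystemGS`, ★ `ShimuraSetGS`).  PROOF FILE (theorems only; no definition, no named fact, no instance, no `sorry`).

(R2) of the (HTR) chain (A-p02 (g14) 2026-08-30 06:09:13Z letter (HTR-rec), step (e); A-plan2 (g13) 06:10:24Z three-module mechanics: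
(R1) `UnitaryShimuraSetGenericStabilizer` ← THIS FILE ← (HEAD) `UnitaryShimuraCurveTranslateRigidity`, the open-immersion form): for the record system ★ `RecordSystemGS` of the
canonical model of `Sh(U(J⋆), 𝔻)`, a Hecke translate `T_k : M_N ⟶ M_N` (★ `RecordSystemGS.IsHeckeTranslate N N k T_k`) whose complex
points fix `[v, bN]` for ONE finite-adelic `b` and all `v` in a NONEMPTY OPEN set `W` of negative vectors is the identity of `M_N`:
(R1) ★ `ShimuraSetGS.exists_rational_central_of_forall_mk_eq` (generic stabiliser: some `γ ∈ U(J⋆)(L⁺) ∩ b k N b⁻¹` is a RATIONAL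
CENTRAL `z·1₂`) gives `kN = zN`; the rational centre acts trivially on every `[v, aN]` (★ `ShimuraSetGS.mk_mul_finAdelicCenter_of_rational`),
so `𝟙` IS a Hecke translate by `k`, and Hecke translates are unique (★ `RecordSystemGS.heckeTranslate_unique`).
[Milne2005ShimuraVarieties] §5 p. 57 («`[x, a] = [γx, γak]`», Lemma 5.13) and Thm. 13.6 p. 118; [Deligne1979ShimuraVarieties] 2.1.2.

Cell `hodgecm-mathlib` (D-0151), crux `HLiu418` = stmt-HodgeConjecture-24832, d6 line, `stub_RosH` glue, cure of the (G4Σ) piece-multiplicity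
obstruction (A-p18 (g12) 06:00:18Z): the translate legs of the push–pull words have UNIFORM piece kernels because a translate trivial on
one complex piece is trivial.  COUNT-NEUTRAL: HC_CM is proved only modulo the 7 printed citations until rung 0 closes; this file discharges
none of them.

## References
* [Milne2005ShimuraVarieties] J. S. Milne, *Introduction to Shimura varieties* (2005/2017): §5 p. 57 and Lemma 5.13; Thm. 13.6 p. 118; Prop. 13.1 p. 117.
* [Deligne1979ShimuraVarieties] P. Deligne, *Variétés de Shimura* (1979): 2.1.2–2.1.4.
-/

set_option autoImplicit false

noncomputable section

open Function MulAction Topology NumberField CategoryTheory Matrix AlgebraicGeometry IsDedekindDomain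
open scoped Matrix ComplexOrder
open Literature.AlgebraicGeometry.Motives
open Literature.NumberTheory.Automorphic Literature.NumberTheory.Automorphic.UnitaryGroup
open Literature.NumberTheory.Automorphic.Liu2021.AppendixC (C5.OpenCompactSubgroup C5.SmallLevel)
open Literature.Geometry.ComplexHyperbolic Literature.Geometry.ComplexHyperbolic.BallModel

namespace Literature.AlgebraicGeometry.ShimuraVarieties.UnitaryCanonicalModel

variable {L : Type} [Field L] [NumberField L] [IsCMField L] {Jstar : Matrix (Fin 2) (Fin 2) L} {τ : L →+* ℂ}
  {K₀ : C5.OpenCompactSubgroup ↥(finAdelic (↥(maximalRealSubfield L)) L (IsCMField.complexConj L) 2 Jstar)}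

/-! ## (R2) A Hecke translate fixing the points `[v, bN]`, `v` in an open set of negative vectors, is `𝟙` -/

/-- **`kN = zN` for a rational central `z` ⇒ `𝟙` is a Hecke translate by `k`**: `[v, a·k N] = [v, a·z·n N] = [v, aN]`
(★ `ShimuraSetGS.mk_mul_of_mem`, ★ `ShimuraSetGS.mk_mul_finAdelicCenter_of_rational`). [cite: Milne2005ShimuraVarieties, §5 p. 57 and Lemma 5.13 p. 57] -/
theorem RecordSystemGS.isHeckeTranslate_id_of_coe_eq_coe_center (S : RecordSystemGS L Jstar τ K₀) (N : C5.SmallLevel K₀)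
    (k : ↥(finAdelic (↥(maximalRealSubfield L)) L (IsCMField.complexConj L) 2 Jstar)) (x : Lˣ)
    (hx : Units.map (algebraMap L (FiniteAdeleRing (𝓞 L) L)).toMonoidHom x ∈
      finAdelicOne (↥(maximalRealSubfield L)) L (IsCMField.complexConj L))
    (hk : ((k : ↥(finAdelic (↥(maximalRealSubfield L)) L (IsCMField.complexConj L) 2 Jstar)) :
          ↥(finAdelic (↥(maximalRealSubfield L)) L (IsCMField.complexConj L) 2 Jstar) ⧸ N.1.1) =
        ((finAdelicCenter (↥(maximalRealSubfield L)) L (IsCMField.complexConj L) 2 Jstar ⟨_, hx⟩ :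
            ↥(finAdelic (↥(maximalRealSubfield L)) L (IsCMField.complexConj L) 2 Jstar)) :
          ↥(finAdelic (↥(maximalRealSubfield L)) L (IsCMField.complexConj L) 2 Jstar) ⧸ N.1.1)) :
    S.IsHeckeTranslate N N k (𝟙 (S.M.obj N)) := by
  letI : Algebra L ℂ := τ.toAlgebra
  intro v hv a
  rw [AlgPoints.map_id_apply, Homeomorph.apply_symm_apply]
  -- `k = z * n` with `n := z⁻¹ k ∈ N`
  have hn : (finAdelicCenter (↥(maximalRealSubfield L)) L (IsCMField.complexConj L) 2 Jstar ⟨_, hx⟩)⁻¹ * k ∈ N.1.1 := by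
    have := QuotientGroup.eq.1 hk.symm
    exact this
  have hk' : k = finAdelicCenter (↥(maximalRealSubfield L)) L (IsCMField.complexConj L) 2 Jstar ⟨_, hx⟩ *
      ((finAdelicCenter (↥(maximalRealSubfield L)) L (IsCMField.complexConj L) 2 Jstar ⟨_, hx⟩)⁻¹ * k) := by
    rw [mul_inv_cancel_left]
  rw [hk', ← mul_assoc, ShimuraSetGS.mk_mul_of_mem L Jstar τ N.1.1 v hv _ hn,
    ShimuraSetGS.mk_mul_finAdelicCenter_of_rational N.1.1 v hv a x hx]

/-- **(R2) Rigidity at the level of points: a Hecke translate `T_k : M_N ⟶ M_N` whose complex points fix `[v, bN]` for one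
finite-adelic `b` and every `v` in a nonempty open set `W` of negative vectors is the identity of `M_N`.**  By (R1)
(★ `ShimuraSetGS.exists_rational_central_of_forall_mk_eq`: generic stabiliser) `b k N = b z N` for a RATIONAL CENTRAL `z = x·1₂`
(`c(x)x = 1`), i.e. `kN = zN`; the rational centre acts trivially on every `[v, aN]` (★ `ShimuraSetGS.mk_mul_finAdelicCenter_of_rational`),
so `𝟙` is a Hecke translate by `k`, and Hecke translates are unique (★ `RecordSystemGS.heckeTranslate_unique`).
[cite: Milne2005ShimuraVarieties, §5 p. 57 (Lemma 5.13) and Thm. 13.6 p. 118] [cite: Deligne1979ShimuraVarieties, 2.1.2–2.1.4] -/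
theorem RecordSystemGS.heckeTranslate_eq_id_of_forall_mk_eq (S : RecordSystemGS L Jstar τ K₀) {N : C5.SmallLevel K₀}
    {k : ↥(finAdelic (↥(maximalRealSubfield L)) L (IsCMField.complexConj L) 2 Jstar)} {Tk : S.M.obj N ⟶ S.M.obj N}
    (hT : S.IsHeckeTranslate N N k Tk)
    (b : ↥(finAdelic (↥(maximalRealSubfield L)) L (IsCMField.complexConj L) 2 Jstar))
    (W : Set (Fin 2 → ℂ)) (hWo : IsOpen W) (hWne : W.Nonempty) (hW : W ⊆ negCone (Jstar.map τ))
    (h : ∀ (v : Fin 2 → ℂ) (hv : v ∈ W),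
      ShimuraSetGS.mk L Jstar τ N.1.1 v (hW hv) (b * k) = ShimuraSetGS.mk L Jstar τ N.1.1 v (hW hv) b) :
    Tk = 𝟙 (S.M.obj N) := by
  obtain ⟨x, hx, hcoset⟩ :=
    ShimuraSetGS.exists_rational_central_of_forall_mk_eq (τ := τ) N.1.1 (b * k) b W hWo hWne hW h
  refine S.heckeTranslate_unique hT (S.isHeckeTranslate_id_of_coe_eq_coe_center N k x hx ?_)
  -- cancel `b` on the left of the coset identity
  rw [QuotientGroup.eq] at hcoset ⊢
  rwa [_root_.mul_inv_rev, mul_assoc, inv_mul_cancel_left] at hcoset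

/-- **(R2′) The same, read through the record's points bijection**: if the complex points `pts⁻¹ [v, bN]`, `v ∈ W`, are FIXED
by `T_k`, then `T_k = 𝟙` (the hypothesis in `AlgPoints` form, as step (c) of the (HTR-rec) letter produces it).
[cite: Milne2005ShimuraVarieties, §5 p. 57 and Thm. 13.6 p. 118] -/
theorem RecordSystemGS.heckeTranslate_eq_id_of_forall_map_eq (S : RecordSystemGS L Jstar τ K₀) {N : C5.SmallLevel K₀}
    {k : ↥(finAdelic (↥(maximalRealSubfield L)) L (IsCMField.complexConj L) 2 Jstar)} {Tk : S.M.obj N ⟶ S.M.obj N}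
    (hT : S.IsHeckeTranslate N N k Tk)
    (b : ↥(finAdelic (↥(maximalRealSubfield L)) L (IsCMField.complexConj L) 2 Jstar))
    (W : Set (Fin 2 → ℂ)) (hWo : IsOpen W) (hWne : W.Nonempty) (hW : W ⊆ negCone (Jstar.map τ))
    (h : letI : Algebra L ℂ := τ.toAlgebra
      ∀ (v : Fin 2 → ℂ) (hv : v ∈ W),
        AlgPoints.map Tk ((S.pts N).symm (ShimuraSetGS.mk L Jstar τ N.1.1 v (hW hv) b)) =
          (S.pts N).symm (ShimuraSetGS.mk L Jstar τ N.1.1 v (hW hv) b)) :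
    Tk = 𝟙 (S.M.obj N) := by
  letI : Algebra L ℂ := τ.toAlgebra
  refine S.heckeTranslate_eq_id_of_forall_mk_eq hT b W hWo hWne hW fun v hv => ?_
  have h1 := hT v (hW hv) b
  rw [h v hv, Homeomorph.apply_symm_apply] at h1
  exact h1.symm

omit [NumberField L] [IsCMField L] in
/-- Naturality of `X(ℂ) ⥲ X_τ(ℂ)` (`AlgPoints.baseChangeEquiv`) in the `L`-scheme: `(x ≫ f)_τ = x_τ ≫ f_τ` (pullback extensionality;
the two-line argument of ★ `UnitaryShimuraCurveLevelQuotient`). [cite: GortzWedhorn2020, §(4.7) eq. (4.7.1)] -/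
private theorem baseChangeEquiv_map_gs' {X Y : SchemeOver L} (f : X ⟶ Y) (x : letI := τ.toAlgebra; ComplexPoints X) :
    (letI := τ.toAlgebra
     AlgPoints.baseChangeEquiv τ Y (AlgPoints.map f x) = AlgPoints.map ((baseChangeHom τ).map f) (AlgPoints.baseChangeEquiv τ X x)) := by
  letI : Algebra L ℂ := τ.toAlgebra
  rw [Equiv.apply_eq_iff_eq_symm_apply]
  apply Over.OverMorphism.ext
  rw [AlgPoints.baseChangeEquiv_symm_apply_left, AlgPoints.map_apply, Over.comp_left, AlgPoints.map_apply, Over.comp_left,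
    Category.assoc, baseChangeHom_map_left_comp_fst, ← Category.assoc, AlgPoints.baseChangeEquiv_apply_left_comp_fst]
  rfl

/-- **(R2″) The same, read on the COMPLEXIFIED curve `(M_N)_τ = M_N ⊗_{L,τ} ℂ`** (the form step (c) of the (HTR-rec) letter meets:
the complex points `x_τ` of `pts⁻¹ [v, bN]`, `v ∈ W`, are fixed by `(T_k)_τ`) ⇒ `T_k = 𝟙`.
[cite: Milne2005ShimuraVarieties, §5 p. 57 and Thm. 13.6 p. 118] [cite: GortzWedhorn2020, §(4.7) eq. (4.7.1)] -/
theorem RecordSystemGS.heckeTranslate_eq_id_of_forall_map_baseChange_eq (S : RecordSystemGS L Jstar τ K₀) {N : C5.SmallLevel K₀}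
    {k : ↥(finAdelic (↥(maximalRealSubfield L)) L (IsCMField.complexConj L) 2 Jstar)} {Tk : S.M.obj N ⟶ S.M.obj N}
    (hT : S.IsHeckeTranslate N N k Tk)
    (b : ↥(finAdelic (↥(maximalRealSubfield L)) L (IsCMField.complexConj L) 2 Jstar))
    (W : Set (Fin 2 → ℂ)) (hWo : IsOpen W) (hWne : W.Nonempty) (hW : W ⊆ negCone (Jstar.map τ))
    (h : letI : Algebra L ℂ := τ.toAlgebra
      ∀ (v : Fin 2 → ℂ) (hv : v ∈ W),
        AlgPoints.map ((baseChangeHom τ).map Tk)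
            (AlgPoints.baseChangeEquiv τ (S.M.obj N) ((S.pts N).symm (ShimuraSetGS.mk L Jstar τ N.1.1 v (hW hv) b))) =
          AlgPoints.baseChangeEquiv τ (S.M.obj N) ((S.pts N).symm (ShimuraSetGS.mk L Jstar τ N.1.1 v (hW hv) b))) :
    Tk = 𝟙 (S.M.obj N) := by
  letI : Algebra L ℂ := τ.toAlgebra
  refine S.heckeTranslate_eq_id_of_forall_map_eq hT b W hWo hWne hW fun v hv => ?_
  apply (AlgPoints.baseChangeEquiv τ (S.M.obj N)).injective
  rw [baseChangeEquiv_map_gs', h v hv]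

end Literature.AlgebraicGeometry.ShimuraVarieties.UnitaryCanonicalModel

end
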